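import Mathlib
import HarnessLib
import Summits.HubbardSuperconductivity.HubbardSuperconductivity.Theorems.KLProgrammeKLRegimeSplitSlotsV17F
import Summits.HubbardSuperconductivity.HubbardSuperconductivity.Theorems.KLProgrammeKLRegimeTwoLegReadJetDefs

/-!
# K3 gen-7-FLOW bundle, REV 2: `klPredsV17F2` = `klPredsV17F` with the (E2-F) array BARE-truncated (cure 1 of k3c2-p2's finding KL STATUS 2026-08-27
# l.2646, T2-2 gate word l.2649/2651) — successor module (the gate is append-only: `…SplitSlotsV17F` p524744 stays untouched, its `klPredsV17F` is SUPERSEDED)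

Cell gate-hubbard-kl, seat p2 g10 (bundle typist).  FINDING (k3c2-p2, T2-2 confirmed by decl): `PairLadderStepAtV17F` (…SplitSlotsV17F §2) reads its entries on
the bare ball `klBall L μ 0` ((β′)) but resums `klPairArray … (K_{n−1}) (n−1) Qm`, whose own truncation (…SplitPredicatesV2 l.101) is the FRAME ball
`klBall L μ K_{n−1}`; the balls differ on the layer `||ε−μ| − Λ₀| ≤ ‖K_{n−1}‖_∞` and are not nested, so on `klBall L μ 0 ∖ klBall L μ K_{n−1}` the clause asks the
full amplitude (`≈ U`) to sit under an `O(U²)` budget — unsatisfiable as typed.  CURE 1 (one def + two tokens, no mathematics; keeps (β′)):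

* `klPairArrayF L M β U μ n Qm` — the scale-`n` amplitudes at the flow frame `K_n` truncated to the BARE ball `klBall L μ 0` (+ the `apply` simp pair);
* `PairLadderStepAtV17F2` — `PairLadderStepAtV17F` with `klPairArray … (K_{n−1}) (n−1) Qm ↦ klPairArrayF … (n−1) Qm` (both occurrences), nothing else;
* `EngineBoundsAtV17F2` (conjunct ORDER KEPT, (E2-F) ↦ (E2-F2)), `histV17F2`, `TwoLegStepV17F2` (history `histV17F2`), **`klPredsV17F2 : Preds`** (= `klPredsV17F` with
  `engine := EngineBoundsAtV17F2`, `twoLeg := TwoLegStepV17F2`; `frameOK`, `renorm`, `split` IDENTICAL), and the `rfl`/`Iff.rfl` bookkeeping twins.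

Everything else of `…SplitSlotsV17F` (§0 flow frame, `frameShiftBar`, (B1-F)/value line/`BetaSplitAtV17F`, (E2″-F)/(E2′-F)/(E2′-F UV)/(E5-F), `TwoLegReadJetsF`,
`TwoLegVolumeRateF`, `RenormFlowAtV17F`, §6 bookkeeping) is REUSED by name.  Consumers re-key four tokens: `klPredsV17F ↦ klPredsV17F2`,
`EngineBoundsAtV17F ↦ EngineBoundsAtV17F2`, `PairLadderStepAtV17F ↦ PairLadderStepAtV17F2`, `TwoLegStepV17F ↦ TwoLegStepV17F2` (and `histV17F ↦ histV17F2`).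
Definitions + bookkeeping only; nothing about the model is asserted; nothing asserts superconductivity.
-/

noncomputable section

namespace Summit.HubbardSuperconductivity.HubbardSuperconductivity.Theorems.KLRegimeSplit

set_option linter.dupNamespace false -- summit = problem name (single-conjunct summit), D-0017

open Real Finset Literature.MathematicalPhysics.QuantumLattice Literature.Probability.LatticeModels
open Literature.MathematicalPhysics.QuantumLattice.FermiRG
open Summit.HubbardSuperconductivity.HubbardSuperconductivity.Theorems.KLProgrammeLegKernels

/-! ## §1 The bare-truncated array and the cured (E2-F) -/

section Model

variable (L M : ℕ) [NeZero L] [NeZero M]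

/-- **The BARE-truncated pair array of the flow action at scale `n`**: the scale-`n` amplitudes at the flow frame `K_n`, truncated to the FRAME-INDEPENDENT
reading ball `klBall L μ 0` ((β′)) — NOT `klPairArray … K_n …`, whose truncation ball `klBall L μ K_n` moves with the frame.  Every landed matrix lemma of
the ladder/value lanes is generic in the truncation set. -/
def klPairArrayF (β U μ : ℝ) (n : ℕ) (Qm : TorusSite 2 L) : Matrix (TorusSite 2 L) (TorusSite 2 L) ℂ :=
  Matrix.of fun k k' => if k ∈ klBall L μ 0 ∧ k' ∈ klBall L μ 0 then klPairAmplitude L M β U μ (klFlowFrameU L M β U μ n) n Qm k k' else 0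

/-- On the bare ball the truncated array IS the amplitude. -/
@[simp] theorem klPairArrayF_apply_of_mem (β U μ : ℝ) (n : ℕ) (Qm : TorusSite 2 L) {k k' : TorusSite 2 L} (hk : k ∈ klBall L μ 0)
    (hk' : k' ∈ klBall L μ 0) : klPairArrayF L M β U μ n Qm k k' = klPairAmplitude L M β U μ (klFlowFrameU L M β U μ n) n Qm k k' := by
  simp [klPairArrayF, hk, hk']

/-- Off the bare ball (first index) the truncated array vanishes. -/
@[simp] theorem klPairArrayF_apply_of_not_mem (β U μ : ℝ) (n : ℕ) (Qm : TorusSite 2 L) {k : TorusSite 2 L} (hk : k ∉ klBall L μ 0)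
    (k' : TorusSite 2 L) : klPairArrayF L M β U μ n Qm k k' = 0 := by
  simp [klPairArrayF, hk]

/-- Off the bare ball (second index) the truncated array vanishes. -/
@[simp] theorem klPairArrayF_apply_of_not_mem_right (β U μ : ℝ) (n : ℕ) (Qm : TorusSite 2 L) (k : TorusSite 2 L) {k' : TorusSite 2 L}
    (hk' : k' ∉ klBall L μ 0) : klPairArrayF L M β U μ n Qm k k' = 0 := by
  simp [klPairArrayF, hk']

/-- **(E2-F2) one pair-ladder step per scale, CROSS-FRAME, cured**: `PairLadderStepAtV17F` with the scale-`(n−1)` array the BARE-truncated `klPairArrayF … (n−1)`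
(truncation AND readings on `klBall L μ 0`); amplitude at `K_n`, flowing slice count at `K_n` (γ′), `+ frameShiftBar P Q U n` — nothing else moves. -/
def PairLadderStepAtV17F2 (G : GeoConsts) (P : SplitConsts) (Q : EngConsts) (β U μ : ℝ) (n : ℕ) : Prop :=
  (n = 0 → ∀ Qm : TorusSite 2 L, ∀ k ∈ klBall L μ 0, ∀ k' ∈ klBall L μ 0,
      ‖klPairAmplitude L M β U μ (klFlowFrameU L M β U μ 0) 0 Qm k k' - (U : ℂ)‖ ≤ initDevBar G U + legDressBarQ2 G P Q U 0 4) ∧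
  (1 ≤ n → ∀ Qm : TorusSite 2 L, IsPairClassAt L Qm n →
      ∃ w : TorusSite 2 L → ℝ, (∑ p, |w p| ≤ G.bhi) ∧ (∑ p, (|w p| - w p) ≤ 2 * klEdge G n (klTorusNorm L Qm)) ∧
        ∃ N : Matrix (TorusSite 2 L) (TorusSite 2 L) ℂ,
          (1 + Matrix.diagonal (fun p => (w p : ℂ)) * klPairArrayF L M β U μ (n - 1) Qm) * N = 1 ∧
          ∀ k ∈ klBall L μ 0, ∀ k' ∈ klBall L μ 0,
            ‖klPairAmplitude L M β U μ (klFlowFrameU L M β U μ n) n Qm k k' - (klPairArrayF L M β U μ (n - 1) Qm * N) k k'‖ ≤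
              drivePBar G P U (n - 1) + eremBar G P Q U β L (n - 1) + thermalBar G P U β n +
                legDressBarQ2 G P Q U n (legSliceCountT L β μ (klFlowFrameU L M β U μ n) n ![k', Qm - k', Qm - k, k]) +
                (P.Klam * U) ^ 2 * (G.phGain n (klTorusNorm L (k - k')) + G.phGain n (klTorusNorm L (k + k' - Qm))) +
                frameShiftBar P Q U n)

/-- **`EngineBoundsAtV17F2`** — `EngineBoundsAtV17F` with (E2-F) ↦ (E2-F2), conjunct ORDER KEPT:
(E0) ∧ (E1-v4) ∧ (E2-F2) ∧ (E2″-F) ∧ (E2′-F) ∧ (E2′-F UV) ∧ (E4) ∧ (E5-F). -/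
def EngineBoundsAtV17F2 (G : GeoConsts) (P : SplitConsts) (Q : EngConsts) (β U μ : ℝ) (n : ℕ) : Prop :=
  SelfEnergySymmetric L M β U μ (klFlowFrameU L M β U μ n) n ∧ KernelNormsV4 L M P Q β U μ (klFlowFrameU L M β U μ n) n ∧
    PairLadderStepAtV17F2 L M G P Q β U μ n ∧ PairValueIncrementAtV17F L M G P Q β U μ n ∧
      QuarticValueIncrementAtV17F L M G P Q β U μ n ∧ QuarticValueUVAtV17F L M G P Q β U μ n ∧
        EngineFirstMoments L M G P Q β U μ (klFlowFrameU L M β U μ n) n ∧ IsoTupleL1AtV17F L M G P β U μ n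

/-! ## §2 The two-leg slot with the cured history, and the bundle -/

/-- The comparison-volume history of the REV-2 bundle at scale `j`: split ∧ renorm ∧ cured engine ∧ reading jets. -/
def histV17F2 (G : GeoConsts) (P : SplitConsts) (Q : EngConsts) (R : RenConsts) (β U μ : ℝ) : ℕ → Prop :=
  fun j => BetaSplitAtV17F L M G P Q β U μ j ∧ RenormFlowAtV17F L M β U μ R j ∧ EngineBoundsAtV17F2 L M G P Q β U μ j ∧
    TwoLegReadJetsF L M G Q β U μ j

/-- **`TwoLegStepV17F2`** := `TwoLegReadJetsF` ∧ `TwoLegSlopes … K_n n` ∧ `TwoLegVolumeRateF` with history `histV17F2` (∧ slopes) — `TwoLegStepV17F` with the cured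
engine in the comparison history, nothing else. -/
def TwoLegStepV17F2 (G : GeoConsts) (P : SplitConsts) (Q : EngConsts) (R : RenConsts) (β U μ : ℝ) (n : ℕ) : Prop :=
  TwoLegReadJetsF L M G Q β U μ n ∧ TwoLegSlopes L M R β U μ (klFlowFrameU L M β U μ n) n ∧
    TwoLegVolumeRateF L M
      (fun L'' M'' _ _ j => histV17F2 L'' M'' G P Q R β U μ j ∧ TwoLegSlopes L'' M'' R β U μ (klFlowFrameU L'' M'' β U μ j) j)
      Q β U μ n

end Model

/-- **`klPredsV17F2 : Preds`** — the gen-7-FLOW bundle of record (rev 2): `klPredsV17F` with `engine := EngineBoundsAtV17F2`, `twoLeg := TwoLegStepV17F2`;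
`frameOK` ((T-a) dummy `K = 0 ∧ FrameOK …`), `renorm := RenormFlowAtV17F`, `split := BetaSplitAtV17F` IDENTICAL.  Children:
`EngineP4 | BetaSplitP | CountertermP2 klPredsV17F2 klWindowC`, `VolumeLimitP2 | TwoPointAssemblyP3 klPredsV17F2 FinalTwoLegVolLimitEx klWindowC`. -/
def klPredsV17F2 : Preds where
  frameOK := fun R U N μ K => K = 0 ∧ FrameOK R U N μ K
  renorm := fun L M _ _ β U μ _ R n => RenormFlowAtV17F L M β U μ R n
  split := fun L M _ _ G P Q β U μ _ n => BetaSplitAtV17F L M G P Q β U μ n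
  engine := fun L M _ _ G P Q β U μ _ n => EngineBoundsAtV17F2 L M G P Q β U μ n
  twoLeg := fun L M _ _ G P Q R β U μ _ n => TwoLegStepV17F2 L M G P Q R β U μ n

/-! ## §3 Bookkeeping -/

/-- The frame class of V17F2 is V17F's: `{0} ∩ FrameOK`. -/
theorem klPredsV17F2_frameOK_iff (R : RenConsts) (U : ℝ) (N : ℕ) (μ : ℝ) (K : TrigPolyC4v) :
    klPredsV17F2.frameOK R U N μ K ↔ K = 0 ∧ FrameOK R U N μ K := Iff.rfl

/-- V17F2's frame class IS V17F's. -/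
theorem klPredsV17F2_frameOK : klPredsV17F2.frameOK = klPredsV17F.frameOK := rfl

/-- V17F2's renormalisation slot IS V17F's. -/
theorem klPredsV17F2_renorm : klPredsV17F2.renorm = klPredsV17F.renorm := rfl

/-- V17F2's split slot IS V17F's. -/
theorem klPredsV17F2_split : klPredsV17F2.split = klPredsV17F.split := rfl

section Model

variable (L M : ℕ) [NeZero L] [NeZero M] (G : GeoConsts) (P : SplitConsts) (Q : EngConsts) (R : RenConsts) (β U μ : ℝ) (K : TrigPolyC4v) (n : ℕ)

/-- V17F2's engine slot ignores `K` and reads `K_n`. -/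
theorem klPredsV17F2_engine_apply : klPredsV17F2.engine L M G P Q β U μ K n = EngineBoundsAtV17F2 L M G P Q β U μ n := rfl

/-- V17F2's split slot, applied. -/
theorem klPredsV17F2_split_apply : klPredsV17F2.split L M G P Q β U μ K n = BetaSplitAtV17F L M G P Q β U μ n := rfl

/-- V17F2's renormalisation slot, applied. -/
theorem klPredsV17F2_renorm_apply : klPredsV17F2.renorm L M β U μ K R n = RenormFlowAtV17F L M β U μ R n := rfl

/-- V17F2's two-leg slot, applied. -/
theorem klPredsV17F2_twoLeg_apply : klPredsV17F2.twoLeg L M G P Q R β U μ K n = TwoLegStepV17F2 L M G P Q R β U μ n := rfl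

/-- **The V17F2 history is the slot facts at `(K_j, j)`, `j < n`, for EVERY dummy `K`** (`Iff.rfl`). -/
theorem histP_klPredsV17F2_iff :
    HistP klPredsV17F2 L M G P Q R β U μ K n ↔
      ∀ j < n, BetaSplitAtV17F L M G P Q β U μ j ∧ RenormFlowAtV17F L M β U μ R j ∧
        EngineBoundsAtV17F2 L M G P Q β U μ j ∧ TwoLegStepV17F2 L M G P Q R β U μ j := Iff.rfl

/-- The V17F2 history does not depend on the dummy frame. -/
theorem histP_klPredsV17F2_frame_irrel (K' : TrigPolyC4v) :
    HistP klPredsV17F2 L M G P Q R β U μ K n ↔ HistP klPredsV17F2 L M G P Q R β U μ K' n := Iff.rfl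

/-- **(E2-F2) vs the rest**: the cured engine slot is V17F's seven untouched conjuncts plus (E2-F2). -/
theorem engineBoundsAtV17F2_iff :
    EngineBoundsAtV17F2 L M G P Q β U μ n ↔
      SelfEnergySymmetric L M β U μ (klFlowFrameU L M β U μ n) n ∧ KernelNormsV4 L M P Q β U μ (klFlowFrameU L M β U μ n) n ∧
        PairLadderStepAtV17F2 L M G P Q β U μ n ∧ PairValueIncrementAtV17F L M G P Q β U μ n ∧
          QuarticValueIncrementAtV17F L M G P Q β U μ n ∧ QuarticValueUVAtV17F L M G P Q β U μ n ∧
            EngineFirstMoments L M G P Q β U μ (klFlowFrameU L M β U μ n) n ∧ IsoTupleL1AtV17F L M G P β U μ n := Iff.rfl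

end Model

section Model

variable {L M : ℕ} [NeZero L] [NeZero M] {G : GeoConsts} {P : SplitConsts} {Q : EngConsts} {R : RenConsts} {β U μ : ℝ}
  {K : TrigPolyC4v} {n : ℕ}

/-- The V17F2 history discharges the comparison history `histV17F2` of the SAME volume at every `j < n`. -/
theorem histV17F2_of_histP (h : HistP klPredsV17F2 L M G P Q R β U μ K n) : ∀ j < n, histV17F2 L M G P Q R β U μ j :=
  fun j hj => ⟨(h j hj).1, (h j hj).2.1, (h j hj).2.2.1, (h j hj).2.2.2.1⟩

/-- (R6-3) at V17F2, route-cone-free form: the dummy class at the bare frame is discharged by ANY proof of `FrameOK R U N μ 0` (e.g. [tree]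
`klFrameOK_zeroC hR U N hμ` on the covariance window, stated in the glue cone). -/
theorem klPredsV17F2_frameOK_zero_of {U : ℝ} {N : ℕ} (h0 : FrameOK R U N μ 0) : klPredsV17F2.frameOK R U N μ 0 := ⟨rfl, h0⟩

/-- The reading-jet conjunct of the rev-2 two-leg slot, in the parametric currency at the package tables. -/
theorem TwoLegStepV17F2.readJets (h : TwoLegStepV17F2 L M G P Q R β U μ n) :
    TwoLegReadJetBound L M G.S Q.S' β U μ (klFlowFrameU L M β U μ n) n := h.1

/-- The slopes conjunct of the rev-2 two-leg slot. -/
theorem TwoLegStepV17F2.slopes (h : TwoLegStepV17F2 L M G P Q R β U μ n) :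
    TwoLegSlopes L M R β U μ (klFlowFrameU L M β U μ n) n := h.2.1

/-- The cured engine slot's (E2-F2) conjunct. -/
theorem EngineBoundsAtV17F2.pairLadderStep (h : EngineBoundsAtV17F2 L M G P Q β U μ n) : PairLadderStepAtV17F2 L M G P Q β U μ n := h.2.2.1

/-- **On the bare ball the (E2-F2) clause reads amplitudes against amplitudes**: the resummed product's entries for `k ∈ klBall L μ 0` involve only
amplitudes at `K_{n−1}` on the bare ball (sanity twin of the finding: no zero row inside the reading ball). -/
theorem klPairArrayF_mul_apply (β U μ : ℝ) (n : ℕ) (Qm : TorusSite 2 L) (N : Matrix (TorusSite 2 L) (TorusSite 2 L) ℂ) {k : TorusSite 2 L}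
    (hk : k ∈ klBall L μ 0) (k' : TorusSite 2 L) :
    (klPairArrayF L M β U μ n Qm * N) k k' =
      ∑ q ∈ klBall L μ 0, klPairAmplitude L M β U μ (klFlowFrameU L M β U μ n) n Qm k q * N q k' := by
  classical
  rw [Matrix.mul_apply, ← Finset.sum_filter_add_sum_filter_not Finset.univ (fun q => q ∈ klBall L μ 0)]
  have h2 : ∑ q ∈ Finset.univ.filter (fun q => ¬ q ∈ klBall L μ 0), klPairArrayF L M β U μ n Qm k q * N q k' = 0 :=
    Finset.sum_eq_zero fun q hq => by rw [klPairArrayF_apply_of_not_mem_right L M β U μ n Qm k (Finset.mem_filter.1 hq).2, zero_mul]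
  rw [h2, add_zero, Finset.filter_mem_eq_inter, Finset.univ_inter]
  exact Finset.sum_congr rfl fun q hq => by rw [klPairArrayF_apply_of_mem L M β U μ n Qm hk hq]

end Model

end Summit.HubbardSuperconductivity.HubbardSuperconductivity.Theorems.KLRegimeSplit

end
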